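import Literature.Computability.AlgebraicComplexity.GraphTensorFlattening
import HarnessLib

/-!
# Odd cycles: the parity cut of `C_k`, `k` odd, is crossed by `k − 1` edges, so `k − 1 ≤ ω(T(C_k))`
# (Christandl–Vrana–Zuiddam 2019, Ex. 1.1.21 `f(C_k) = k − 1`, Thm. 1.1.24 lower bound)

Topic `Literature/Computability/AlgebraicComplexity`, sequel of `GraphTensorFlattening.lean` (`crosses`, `parityCut`,
`card_crossing_le_graphOmega`, `graphOmega_cycleSlots_of_even`).  Everything here is PROVED (no named fact): the
LOWER bound of the odd clause of the named fact `cvz19_thm_1_1_24` (`GraphTensor.lean`); its upper bound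
`ω(T(C_k)) ≤ (k−1)/2 · ω` (a cover by `(k−1)/2` matrix multiplications and one extra vertex, via Kronecker powers)
is not re-proved here.

## What is printed

[CVZ19] Christandl–Vrana–Zuiddam, arXiv:1609.07476, Ex. 1.1.21 (p. 6): "let `φ = T(C_k)`. Then `g(C_k) = 2` and
`f(C_k) = k − 1`" [`f` = max-cut; for odd `k`], with "`f(G) ≤ ω(T(G))`"; Thm. 1.1.24 (p. 7): "`k − 1 ≤ ω(T(C_k))
≤ (k−1)/2 · ω` when `k` is odd."

## What is typed (all PROVED)

* `crosses_cycleSlots_parityCut_iff_of_odd`: for odd `k`, the edge `e` of `C_k` (joining `e` and `e + 1`) crosses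
  the parity cut iff `e ≠ k − 1` (the wrap-around edge joins the two even vertices `k − 1` and `0`);
* `card_crossing_cycleSlots_parityCut_of_odd : #{crossing} = k − 1`;
* **`pred_le_graphOmega_cycleSlots_of_odd : k − 1 ≤ ω(T(C_k))`** for odd `k` (every field), and the `ℂ`-instance
  `cvz19_thm_1_1_24_odd_lower`.

No `sorry`, no axiom, no instance, no notation, no `Prop`-valued definition.

## References

* [CVZ19] Christandl–Vrana–Zuiddam, arXiv:1609.07476, Ex. 1.1.21, Thm. 1.1.24.  [ChristandlVranaZuiddam2016]
-/

noncomputable section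

open scoped BigOperators

namespace Literature.Computability.AlgebraicComplexity

section OddCycles

variable (F : Type*) [Field F]

/-- The vertices reading the edge `e` of `C_k` are exactly `e` (slot `0`) and `e + 1` (slot `1`).
[cite: ChristandlVranaZuiddam2016, Ex. 1.1.2] -/
theorem cycleSlots_eq_iff {k : ℕ} [NeZero k] (v : Fin k) (j : Fin 2) (e : Fin k) :
    cycleSlots k v j = e ↔ (j = 0 ∧ v = e) ∨ (j = 1 ∧ v = e + 1) := by
  fin_cases j
  · simp [cycleSlots]
  · simp only [cycleSlots, Fin.mk_one, Fin.isValue, Matrix.cons_val_one, Matrix.cons_val_fin_one,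
      one_ne_zero, false_and, true_and, false_or]
    constructor
    · rintro rfl; simp
    · rintro rfl; simp

/-- For odd `k`, the values of `e` and `e + 1` in `Fin k` have different parities unless `e = k − 1`
(then `e + 1 = 0` and both are even). [cite: ChristandlVranaZuiddam2016, Ex. 1.1.21] -/
theorem parity_succ_ne_iff_of_odd {k : ℕ} [NeZero k] (hk : Odd k) (e : Fin k) :
    (e + 1 : Fin k).val % 2 ≠ e.val % 2 ↔ e.val ≠ k - 1 := by
  obtain ⟨m, hm⟩ := hk
  rcases Nat.lt_or_ge 1 k with h1k | h1k
  · have hval : (e + 1 : Fin k).val = (e.val + 1) % k := by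
      rw [Fin.val_add, Fin.val_one', Nat.mod_eq_of_lt h1k]
    rw [hval]
    by_cases hlast : e.val = k - 1
    · have hek : e.val + 1 = k := by omega
      rw [hek, Nat.mod_self]
      constructor
      · intro h; omega
      · intro h; exact absurd hlast h
    · have hlt : e.val + 1 < k := by have := e.isLt; omega
      rw [Nat.mod_eq_of_lt hlt]
      constructor
      · intro _; exact hlast
      · intro _; omega
  · -- `k = 1`: the single vertex `0`, the single (loop) edge `0`
    have hk1 : k = 1 := by have := NeZero.one_le (n := k); omega
    subst hk1
    have he : e = 0 := Fin.eq_zero e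
    subst he
    simp

/-- **For odd `k`, the edge `e` of `C_k` crosses the parity cut iff `e ≠ k − 1`.**
[cite: ChristandlVranaZuiddam2016, Ex. 1.1.21] -/
theorem crosses_cycleSlots_parityCut_iff_of_odd {k : ℕ} [NeZero k] (hk : Odd k) (e : Fin k) :
    crosses (cycleSlots k) (parityCut k) e = true ↔ e.val ≠ k - 1 := by
  rw [crosses_iff, ← parity_succ_ne_iff_of_odd hk e]
  constructor
  · rintro ⟨⟨v, j, hv, hvj⟩, ⟨w, j', hw, hwj⟩⟩
    simp only [parityCut, decide_eq_true_eq, decide_eq_false_iff_not] at hv hw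
    rcases (cycleSlots_eq_iff v j e).1 hvj with ⟨-, hv'⟩ | ⟨-, hv'⟩ <;>
      rcases (cycleSlots_eq_iff w j' e).1 hwj with ⟨-, hw'⟩ | ⟨-, hw'⟩ <;>
      · rw [hv'] at hv; rw [hw'] at hw; omega
  · intro hpar
    have h0 : cycleSlots k e 0 = e := (cycleSlots_eq_iff e 0 e).2 (Or.inl ⟨rfl, rfl⟩)
    have h1 : cycleSlots k (e + 1) 1 = e := (cycleSlots_eq_iff (e + 1) 1 e).2 (Or.inr ⟨rfl, rfl⟩)
    by_cases he : e.val % 2 = 0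
    · refine ⟨⟨e, 0, ?_, h0⟩, ⟨e + 1, 1, ?_, h1⟩⟩
      · simpa [parityCut] using he
      · simp only [parityCut, decide_eq_false_iff_not]; omega
    · refine ⟨⟨e + 1, 1, ?_, h1⟩, ⟨e, 0, ?_, h0⟩⟩
      · simp only [parityCut, decide_eq_true_eq]; omega
      · simpa [parityCut] using he

/-- For odd `k`, exactly `k − 1` edges of `C_k` cross the parity cut (`f(C_k) = k − 1`).
[cite: ChristandlVranaZuiddam2016, Ex. 1.1.21] -/
theorem card_crossing_cycleSlots_parityCut_of_odd {k : ℕ} [NeZero k] (hk : Odd k) :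
    Fintype.card {e : Fin k // crosses (cycleSlots k) (parityCut k) e = true} = k - 1 := by
  have h : Fintype.card {e : Fin k // crosses (cycleSlots k) (parityCut k) e = true} =
      Fintype.card {e : Fin k // e ≠ ⟨k - 1, by have := NeZero.pos k; omega⟩} := by
    apply Fintype.card_congr
    refine Equiv.subtypeEquivRight fun e => ?_
    rw [crosses_cycleSlots_parityCut_iff_of_odd hk]
    exact not_congr ⟨fun h => Fin.ext h, fun h => congrArg Fin.val h⟩
  rw [h, Fintype.card_subtype_compl, Fintype.card_fin, Fintype.card_unique]

/-- **CVZ19 Thm. 1.1.24, odd cycles, lower bound: `k − 1 ≤ ω(T(C_k))`** for odd `k` (every field), by the flattening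
along the parity cut (Ex. 1.1.21, `f(C_k) = k − 1`). [cite: ChristandlVranaZuiddam2016, Thm. 1.1.24] -/
theorem pred_le_graphOmega_cycleSlots_of_odd {k : ℕ} [NeZero k] (hk : Odd k) :
    ((k - 1 : ℕ) : ℝ) ≤ graphOmega F (cycleSlots k) := by
  have h := card_crossing_le_graphOmega (F := F) (cycleSlots_covering k) (parityCut k)
  rwa [card_crossing_cycleSlots_parityCut_of_odd hk] at h

/-- The lower half of the odd clause of the named fact `cvz19_thm_1_1_24`, in its `ℝ`-subtraction form.
[cite: ChristandlVranaZuiddam2016, Thm. 1.1.24] -/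
theorem cvz19_thm_1_1_24_odd_lower (k : ℕ) [NeZero k] (hk : Odd k) : (k : ℝ) - 1 ≤ graphOmega ℂ (cycleSlots k) := by
  have h := pred_le_graphOmega_cycleSlots_of_odd ℂ hk
  have h1 : 1 ≤ k := NeZero.one_le
  push_cast [Nat.cast_sub h1] at h
  exact h

end OddCycles

end Literature.Computability.AlgebraicComplexity

end
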